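import Summits.BirchSwinnertonDyer.BirchSwinnertonDyer.Theorems.ByReductionTypeAtTwoMultTowerNS2LayerZeroFlip
import HarnessLib

/-!
# Route `ByReductionTypeAtTwo`, crux `MultUpperHalfAtTwo` (item stmt-BirchSwinnertonDyer-19922), TOWER road, NON-SPLIT rows:
# the layer-`0` order of the local tower kernel at a non-split `2`, part 2 — the class of the `2`-torsion point `Ψ(−1)`
# in the layer-`0` coinvariants DIES when `ord₂(q_E)` is ODD (Tamagawa `c₂ = 1`)

HONEST FRAMING (cell `bsd-2adic`, run/shared/lean/pub/bsd-2adic/, seat `bsd-2adic-tower-1` GEN 29, HUMAN RULINGS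
D-0036 / D-0054 / D-0074): TOOL theorems only (no definition, no named fact, no `sorry`); closes nothing by itself;
nothing booked; BSD is not proved by any of this. Second brick of the layer-`0` count `#𝒦_{v,0}[2^∞] = 2·c₂^{(2)}` at a
non-split multiplicative `2` (Greenberg LNM 1716 §3 p. 93 / §4 p. 113; scope memo `tower/SCOPE-NS2-LAYER0-EXACT-GEN29.md`;
part 1 `…MultTowerNS2LayerZeroFlip`: the class of `Ψ(−1)` SURVIVES when `ord₂ q_E` is even). Same setting (`v ∋ 2`, `t` with
`σt = ±t`, a flip `τ₀ ∈ H_∞`, a generator `g` at the layer `0` fixing `t`, `Q = q_E`, the spectral valuation `w`).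

* `exists_spectralValuation_eq_zpow_of_stabilizer` — the value group of `K̄_v^{Stab t} = ℚ_v(t)` is `|2|^ℤ`: the inertia group
  fixes `t` at a multiplicative `2` (X11a `inertia_fix_sqrt_gamma_two`), so `ℚ_v(t) ⊆ ℚ_v^nr`
  (`exists_spectralValuation_eq_pow_of_forall_inertia`);
* `exists_norm_eq_of_unit` — every `Γ`-fixed UNIT `c` (`|c| = 1`) is a norm `f·τ₀f` from `ℚ_v(t)` (the quadratic class field
  input BRICK 17 `exists_norm_rel_of_three` at the layer `0` applied to `c, 1, 2`: the two other alternatives would make `2` a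
  norm up to units, of odd valuation — impossible in `|2|^{2ℤ}`);
* `exists_generator_smul_eq_neg_of_odd` — **if `|Q|_v = |2|_v^m` with `m` ODD there is `x₁ ≠ 0`, fixed by `H_∞ ∩ Stab(t)`, with
  `τ₀x₁·x₁ = Q` and `g x₁ = −x₁`**: `x₁ = y₁^m·f₀` with `y₁² = 2`, `g y₁ = −y₁` (part 1) and `f₀·τ₀f₀ = Q/2^m`;
* `exists_neg_one_eq_zpow_mul_coboundary_of_odd` — hence `−1 = Q⁰ · (g x₁/x₁)`: in the coinvariants `M_∞/(g−1)M_∞` of the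
  twisted Tate module the class of `Ψ(−1)` is ZERO when `ord₂ q_E` is odd (`Ψ(−1) = gΨ(x₁) − Ψ(x₁)`), the exact complement of
  part 1's `neg_one_ne_zpow_mul_coboundary_of_even`.

References: R. Greenberg, LNM 1716 (1999), §3 p. 93, §4 p. 113; J. Silverman, GTM 151, V.5; J. Neukirch, *ANT* II (7.5), V (1.1).
-/

set_option autoImplicit false
-- the Theorems namespace of this sub repeats the summit name by design (D-0017 nested layout: Summit.<S>.<Sub>)
set_option linter.dupNamespace false

noncomputable section

open scoped Classical IntermediateField NNReal

namespace Summit.BirchSwinnertonDyer.BirchSwinnertonDyer.Theorems.MultTowerNS2LayerZero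

open NumberField IsDedekindDomain Field WeierstrassCurve PadicInt Rat.HeightOneSpectrum
  Literature.NumberTheory.EllipticCurves Literature.NumberTheory.GaloisRepresentations
  Summit.BirchSwinnertonDyer.BirchSwinnertonDyer.Theorems.MultTowerNS2 IsDedekindDomain.HeightOneSpectrum

variable {κ : ZpExtension ℚ 2}

/-! ### The value group of `ℚ_v(t)` -/

/-- **The value group of `K̄_v^{Stab t}` is `|2|^ℤ`** at a multiplicative `2`: a non-zero element fixed by every `σ` with
`σt = t` (`t² = γ(W)`) has spectral valuation `|2|_v^k` for some `k ∈ ℤ` — the inertia group fixes `t`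
(X11a `inertia_fix_sqrt_gamma_two`), and elements of `ℚ_v^nr` have integral levels
(`exists_spectralValuation_eq_pow_of_forall_inertia`). [cite: NeukirchANT1999, Ch. II (7.5), (9.3)]
[cite: SilvermanATAEC1994, Ch. V Lemma 5.2 (c)] -/
theorem exists_spectralValuation_eq_zpow_of_stabilizer (W : WeierstrassCurve ℚ) [W.IsElliptic] [W.IsGloballyMinimal]
    (hmult : W.HasMultiplicativeReductionAtPrime 2) (v : HeightOneSpectrum (𝓞 ℚ)) (hv : ((2 : ℕ) : 𝓞 ℚ) ∈ v.asIdeal)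
    {t : AlgebraicClosure (v.adicCompletion ℚ)}
    (ht2 : t ^ 2 = algebraMap (v.adicCompletion ℚ) (AlgebraicClosure (v.adicCompletion ℚ))
      (algebraMap ℚ (v.adicCompletion ℚ) (-(W.c₄ / W.c₆))))
    {w : Valuation (AlgebraicClosure (v.adicCompletion ℚ)) ℝ≥0}
    (hw : ∀ x, (w x : ℝ) = spectralNorm (v.adicCompletion ℚ) (AlgebraicClosure (v.adicCompletion ℚ)) x)
    {x : AlgebraicClosure (v.adicCompletion ℚ)} (hx0 : x ≠ 0)
    (hx : ∀ σ : absoluteGaloisGroup (v.adicCompletion ℚ), σ • t = t → σ • x = x) :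
    ∃ k : ℤ, w x = w 2 ^ k := by
  set K := v.adicCompletion ℚ with hK
  obtain ⟨𝔐, h𝔐⟩ := v.localPrimesAbove_nonempty
  have hϖ : Irreducible ((2 : ℕ) : v.adicCompletionIntegers ℚ) := irreducible_natCast_adicCompletionIntegers_rat hv
  have hI : ∀ σ ∈ 𝔐.inertia (absoluteGaloisGroup K), absoluteGaloisGroup.toAlgEquiv K σ x = x := fun σ hσ ↦
    hx σ (Rank1Residual.X11a.SelmerCompanion.inertia_fix_sqrt_gamma_two W hmult hv h𝔐 t ht2 σ hσ)
  have h2 : w (algebraMap K (AlgebraicClosure K) ((((2 : ℕ) : v.adicCompletionIntegers ℚ) : K))) = w 2 := by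
    have h2K : ((((2 : ℕ) : v.adicCompletionIntegers ℚ) : K)) = (2 : K) := by norm_cast
    rw [h2K, map_ofNat]
  have hxpos : 0 < w x := zero_lt_iff.mpr ((Valuation.ne_zero_iff _).mpr hx0)
  rcases lt_trichotomy (w x) 1 with h | h | h
  · obtain ⟨k, -, hk⟩ := exists_spectralValuation_eq_pow_of_forall_inertia hw h𝔐 hϖ hI hxpos h
    exact ⟨k, by rw [hk, h2, zpow_natCast]⟩
  · exact ⟨0, by rw [h, zpow_zero]⟩
  · have hI' : ∀ σ ∈ 𝔐.inertia (absoluteGaloisGroup K), absoluteGaloisGroup.toAlgEquiv K σ x⁻¹ = x⁻¹ :=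
      fun σ hσ ↦ by rw [map_inv₀, hI σ hσ]
    obtain ⟨k, -, hk⟩ := exists_spectralValuation_eq_pow_of_forall_inertia hw h𝔐 hϖ hI'
      (by rw [map_inv₀]; exact inv_pos.mpr hxpos) (by rw [map_inv₀]; exact inv_lt_one_of_one_lt₀ h)
    refine ⟨-(k : ℤ), ?_⟩
    rw [map_inv₀, h2] at hk
    rw [zpow_neg, zpow_natCast, ← hk, inv_inv]

/-! ### Units of `ℚ_v` are norms from `ℚ_v(t)` -/

/-- **A `Γ`-fixed unit is a norm from `ℚ_v(t)`.** For `c ∈ K̄_v` fixed by `Γ_{ℚ_v}` with `|c|_v = 1` there is `f₀ ≠ 0`, fixed by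
`Stab(t)`, with `c = f₀·τ₀f₀`: the quadratic class field input at the layer `0` (BRICK 17 `exists_norm_rel_of_three` on
`c, 1, 2`) leaves three alternatives, and the two involving `2` would give a norm of odd valuation, impossible since norms
from `ℚ_v(t) ⊆ ℚ_v^nr` have valuation in `|2|^{2ℤ}`. [cite: NeukirchANT1999, Ch. V §1 Thm. (1.1), Ch. II (7.5)]
[cite: SilvermanATAEC1994, Ch. V Lemma 5.2 (c)] -/
theorem exists_norm_eq_of_unit (W : WeierstrassCurve ℚ) [W.IsElliptic] [W.IsGloballyMinimal]
    (hmult : W.HasMultiplicativeReductionAtPrime 2) (hκ : κ.IsCyclotomic) (v : HeightOneSpectrum (𝓞 ℚ))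
    (hv : ((2 : ℕ) : 𝓞 ℚ) ∈ v.asIdeal) {t : AlgebraicClosure (v.adicCompletion ℚ)}
    (ht2 : t ^ 2 = algebraMap (v.adicCompletion ℚ) (AlgebraicClosure (v.adicCompletion ℚ))
      (algebraMap ℚ (v.adicCompletion ℚ) (-(W.c₄ / W.c₆))))
    (ht : ∀ σ : absoluteGaloisGroup (v.adicCompletion ℚ), σ • t = t ∨ σ • t = -t) (ht0 : t ≠ 0)
    {τ₀ : absoluteGaloisGroup (v.adicCompletion ℚ)} (hτ₀t : τ₀ • t = -t)
    {w : Valuation (AlgebraicClosure (v.adicCompletion ℚ)) ℝ≥0}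
    (hw : ∀ x, (w x : ℝ) = spectralNorm (v.adicCompletion ℚ) (AlgebraicClosure (v.adicCompletion ℚ)) x)
    {c : AlgebraicClosure (v.adicCompletion ℚ)} (hcfix : ∀ σ : absoluteGaloisGroup (v.adicCompletion ℚ), σ • c = c)
    (hc1 : w c = 1) :
    ∃ f₀ : AlgebraicClosure (v.adicCompletion ℚ), f₀ ≠ 0 ∧
      (∀ σ : absoluteGaloisGroup (v.adicCompletion ℚ), σ • t = t → σ • f₀ = f₀) ∧ c = f₀ * τ₀ • f₀ := by
  set K := v.adicCompletion ℚ with hK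
  -- the layer `0`: `H₀ = Γ`
  have hmem0 : ∀ σ : absoluteGaloisGroup K, σ ∈ localSubgroup (κ.layerSubgroup 0) K := fun σ ↦ by
    rw [mem_localSubgroup_iff, ZpExtension.mem_layerSubgroup]
    exact ⟨(κ (resGal (K := ℚ) K σ)).toAdd, by rw [pow_zero, one_mul]⟩
  have hc0 : c ≠ 0 := fun h ↦ by rw [h, map_zero] at hc1; exact zero_ne_one hc1
  have h20 : (2 : AlgebraicClosure K) ≠ 0 := by
    haveI : CharZero (AlgebraicClosure K) := charZero_of_injective_algebraMap (algebraMap ℚ (AlgebraicClosure K)).injective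
    exact two_ne_zero
  have h2fix : ∀ σ : absoluteGaloisGroup K, σ • (2 : AlgebraicClosure K) = 2 := fun σ ↦ by
    change absoluteGaloisGroup.toAlgEquiv K σ 2 = 2
    exact map_ofNat _ 2
  obtain ⟨f₀, hf₀0, hf₀S, hrel⟩ := exists_norm_rel_of_three hκ v hv 0 ht ht0 (hmem0 τ₀) hτ₀t c 1 2 hc0 one_ne_zero h20
    (fun h _ ↦ hcfix h) (fun h _ ↦ by change absoluteGaloisGroup.toAlgEquiv K h 1 = 1; exact map_one _)
    (fun h _ ↦ h2fix h)
  have hf₀S' : ∀ σ : absoluteGaloisGroup K, σ • t = t → σ • f₀ = f₀ := fun σ hσt ↦ hf₀S σ (hmem0 σ) hσt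
  -- the valuation of `f₀ τ₀ f₀` is an EVEN power of `|2|`
  obtain ⟨k, hk⟩ := exists_spectralValuation_eq_zpow_of_stabilizer W hmult v hv ht2 hw hf₀0 hf₀S'
  have hN : w (f₀ * τ₀ • f₀) = w 2 ^ (2 * k) := by
    rw [map_mul, spectralValuation_smul hw, hk, two_mul, zpow_add₀]
    obtain ⟨h2p, -⟩ := spectralValuation_uniformizer_pos_lt_one hw (irreducible_natCast_adicCompletionIntegers_rat hv)
    have h2K : ((((2 : ℕ) : v.adicCompletionIntegers ℚ) : K)) = (2 : K) := by norm_cast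
    rw [h2K, map_ofNat] at h2p
    exact h2p.ne'
  obtain ⟨h2p, h2lt⟩ := spectralValuation_uniformizer_pos_lt_one hw (irreducible_natCast_adicCompletionIntegers_rat hv)
  have h2K : ((((2 : ℕ) : v.adicCompletionIntegers ℚ) : K)) = (2 : K) := by norm_cast
  rw [h2K, map_ofNat] at h2p h2lt
  have hinj := (zpow_right_strictAnti₀ h2p h2lt).injective
  rcases hrel with h | h | h
  · exact ⟨f₀, hf₀0, hf₀S', by rw [h, mul_one]⟩
  · -- `c = f₀ τ₀f₀ · 2`: valuations `1 = |2|^{2k+1}`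
    exfalso
    have e : w 2 ^ (0 : ℤ) = w 2 ^ (2 * k + 1) := by
      rw [zpow_zero, ← hc1, h, map_mul, hN, zpow_add₀ h2p.ne', zpow_one]
    have := hinj e
    omega
  · -- `1 = f₀ τ₀f₀ · 2`
    exfalso
    have e : w 2 ^ (0 : ℤ) = w 2 ^ (2 * k + 1) := by
      rw [zpow_zero, ← map_one w, h, map_mul, hN, zpow_add₀ h2p.ne', zpow_one]
    have := hinj e
    omega

/-! ### The flip class dies when `ord₂ q_E` is odd -/

/-- **An anti-invariant element of norm `Q` when `ord₂ q_E` is ODD.** With `|Q|_v = |2|_v^m`, `m` odd: there is `x₁ ≠ 0`, fixed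
by `H_∞ ∩ Stab(t)`, with `τ₀x₁·x₁ = Q` and `g x₁ = −x₁` — namely `x₁ = y₁^m·f₀` with `y₁² = 2`, `g y₁ = −y₁` (part 1
`exists_sqrt_two_layer_one`) and `f₀·τ₀f₀ = Q/2^m` (`exists_norm_eq_of_unit`).
[cite: GreenbergLNM1716, §3 p. 93 and §4 p. 113] [cite: SilvermanATAEC1994, Ch. V Thm. 5.3] -/
theorem exists_generator_smul_eq_neg_of_odd (W : WeierstrassCurve ℚ) [W.IsElliptic] [W.IsGloballyMinimal]
    (hmult : W.HasMultiplicativeReductionAtPrime 2) (hκ : κ.IsCyclotomic) (v : HeightOneSpectrum (𝓞 ℚ))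
    (hv : ((2 : ℕ) : 𝓞 ℚ) ∈ v.asIdeal) {t : AlgebraicClosure (v.adicCompletion ℚ)}
    (ht2 : t ^ 2 = algebraMap (v.adicCompletion ℚ) (AlgebraicClosure (v.adicCompletion ℚ))
      (algebraMap ℚ (v.adicCompletion ℚ) (-(W.c₄ / W.c₆))))
    (ht : ∀ σ : absoluteGaloisGroup (v.adicCompletion ℚ), σ • t = t ∨ σ • t = -t) (ht0 : t ≠ 0)
    {τ₀ : absoluteGaloisGroup (v.adicCompletion ℚ)} (hτ₀ : τ₀ ∈ localSubgroup κ.kerSubgroup (v.adicCompletion ℚ))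
    (hτ₀t : τ₀ • t = -t) {g : absoluteGaloisGroup (v.adicCompletion ℚ)} {u : ℤ_[2]ˣ}
    (hu : ((κ (resGal (K := ℚ) (v.adicCompletion ℚ) g)).toAdd : ℤ_[2]) = 2 ^ 0 * (u : ℤ_[2])) (hgt : g • t = t)
    {Q : AlgebraicClosure (v.adicCompletion ℚ)} (hQfix : ∀ σ : absoluteGaloisGroup (v.adicCompletion ℚ), σ • Q = Q)
    {w : Valuation (AlgebraicClosure (v.adicCompletion ℚ)) ℝ≥0}
    (hw : ∀ x, (w x : ℝ) = spectralNorm (v.adicCompletion ℚ) (AlgebraicClosure (v.adicCompletion ℚ)) x)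
    {m : ℕ} (hQm : w Q = w 2 ^ m) (hm : Odd m) :
    ∃ x₁ : AlgebraicClosure (v.adicCompletion ℚ), x₁ ≠ 0 ∧
      (∀ h ∈ localSubgroup κ.kerSubgroup (v.adicCompletion ℚ), h • t = t → h • x₁ = x₁) ∧
      τ₀ • x₁ * x₁ = Q ∧ g • x₁ = -x₁ := by
  set K := v.adicCompletion ℚ with hK
  -- `y₁`
  obtain ⟨y, hy2, hyH1, hgy⟩ := exists_sqrt_two_layer_one hκ v hv hu
  have h20 : (2 : AlgebraicClosure K) ≠ 0 := by
    haveI : CharZero (AlgebraicClosure K) := charZero_of_injective_algebraMap (algebraMap ℚ (AlgebraicClosure K)).injective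
    exact two_ne_zero
  have hy0 : y ≠ 0 := by
    intro h; rw [h, zero_pow two_ne_zero] at hy2; exact h20 hy2.symm
  have hile : localSubgroup κ.kerSubgroup K ≤ localSubgroup (κ.layerSubgroup 1) K := fun τ hτ ↦ by
    rw [mem_localSubgroup_iff] at hτ ⊢
    exact κ.kerSubgroup_le_layerSubgroup 1 hτ
  have hτy : τ₀ • y = y := hyH1 τ₀ (hile hτ₀)
  -- the unit `c = Q / 2^m` and `f₀` with `f₀ τ₀ f₀ = c`
  set c : AlgebraicClosure K := Q / 2 ^ m with hc
  have hcfix : ∀ σ : absoluteGaloisGroup K, σ • c = c := fun σ ↦ by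
    rw [hc, smul_div₀', hQfix, smul_pow']
    congr 2
    change absoluteGaloisGroup.toAlgEquiv K σ 2 = 2
    exact map_ofNat _ 2
  have hc1 : w c = 1 := by
    rw [hc, map_div₀, map_pow, hQm, div_self (pow_ne_zero _ _)]
    obtain ⟨h2p, -⟩ := spectralValuation_uniformizer_pos_lt_one hw (irreducible_natCast_adicCompletionIntegers_rat hv)
    have h2K : ((((2 : ℕ) : v.adicCompletionIntegers ℚ) : K)) = (2 : K) := by norm_cast
    rw [h2K, map_ofNat] at h2p
    exact h2p.ne'
  obtain ⟨f₀, hf₀0, hf₀S, hcf⟩ := exists_norm_eq_of_unit W hmult hκ v hv ht2 ht ht0 hτ₀t hw hcfix hc1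
  -- `x₁ = y^m f₀`
  refine ⟨y ^ m * f₀, mul_ne_zero (pow_ne_zero _ hy0) hf₀0, fun h hh hht ↦ ?_, ?_, ?_⟩
  · rw [smul_mul', smul_pow', hyH1 h (hile hh), hf₀S h hht]
  · rw [smul_mul', smul_pow', hτy]
    calc y ^ m * τ₀ • f₀ * (y ^ m * f₀) = (y ^ 2) ^ m * (f₀ * τ₀ • f₀) := by ring
      _ = Q := by rw [hy2, ← hcf, hc, mul_div_cancel₀ _ (pow_ne_zero _ h20)]
  · rw [smul_mul', smul_pow', hgy, hf₀S g hgt, Odd.neg_pow hm, neg_mul]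

/-- **The flip class is a coboundary when `ord₂ q_E` is ODD**: with `|Q|_v = |2|_v^m`, `m` odd, there are `z ≠ 0` fixed by
`H_∞ ∩ Stab(t)` with `τ₀z·z = Q^a` and `j` such that `−1 = Qʲ · (gz/z)` (indeed `j = 0`, `a = 1`, `z = x₁` of
`exists_generator_smul_eq_neg_of_odd`) — the exact complement of part 1's `neg_one_ne_zpow_mul_coboundary_of_even`: in the
coinvariants `M_∞/(g−1)M_∞` of the twisted Tate module, `[Ψ(−1)] = 0` iff `ord₂ q_E` is odd (Tamagawa `c₂ = 1`).
[cite: GreenbergLNM1716, §3 p. 93 and §4 p. 113] -/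
theorem exists_neg_one_eq_zpow_mul_coboundary_of_odd (W : WeierstrassCurve ℚ) [W.IsElliptic] [W.IsGloballyMinimal]
    (hmult : W.HasMultiplicativeReductionAtPrime 2) (hκ : κ.IsCyclotomic) (v : HeightOneSpectrum (𝓞 ℚ))
    (hv : ((2 : ℕ) : 𝓞 ℚ) ∈ v.asIdeal) {t : AlgebraicClosure (v.adicCompletion ℚ)}
    (ht2 : t ^ 2 = algebraMap (v.adicCompletion ℚ) (AlgebraicClosure (v.adicCompletion ℚ))
      (algebraMap ℚ (v.adicCompletion ℚ) (-(W.c₄ / W.c₆))))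
    (ht : ∀ σ : absoluteGaloisGroup (v.adicCompletion ℚ), σ • t = t ∨ σ • t = -t) (ht0 : t ≠ 0)
    {τ₀ : absoluteGaloisGroup (v.adicCompletion ℚ)} (hτ₀ : τ₀ ∈ localSubgroup κ.kerSubgroup (v.adicCompletion ℚ))
    (hτ₀t : τ₀ • t = -t) {g : absoluteGaloisGroup (v.adicCompletion ℚ)} {u : ℤ_[2]ˣ}
    (hu : ((κ (resGal (K := ℚ) (v.adicCompletion ℚ) g)).toAdd : ℤ_[2]) = 2 ^ 0 * (u : ℤ_[2])) (hgt : g • t = t)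
    {Q : AlgebraicClosure (v.adicCompletion ℚ)} (hQfix : ∀ σ : absoluteGaloisGroup (v.adicCompletion ℚ), σ • Q = Q)
    {w : Valuation (AlgebraicClosure (v.adicCompletion ℚ)) ℝ≥0}
    (hw : ∀ x, (w x : ℝ) = spectralNorm (v.adicCompletion ℚ) (AlgebraicClosure (v.adicCompletion ℚ)) x)
    {m : ℕ} (hQm : w Q = w 2 ^ m) (hm : Odd m) :
    ∃ (z : AlgebraicClosure (v.adicCompletion ℚ)) (a j : ℤ), z ≠ 0 ∧
      (∀ h ∈ localSubgroup κ.kerSubgroup (v.adicCompletion ℚ), h • t = t → h • z = z) ∧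
      τ₀ • z * z = Q ^ a ∧ -1 = Q ^ j * (g • z / z) := by
  obtain ⟨x₁, hx0, hxL, hxQ, hgx⟩ :=
    exists_generator_smul_eq_neg_of_odd W hmult hκ v hv ht2 ht ht0 hτ₀ hτ₀t hu hgt hQfix hw hQm hm
  refine ⟨x₁, 1, 0, hx0, hxL, by rw [zpow_one]; exact hxQ, ?_⟩
  rw [zpow_zero, one_mul, hgx, neg_div, div_self hx0]

end Summit.BirchSwinnertonDyer.BirchSwinnertonDyer.Theorems.MultTowerNS2LayerZero

end
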